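import Mathlib.Algebra.BigOperators.Group.Finset.Basic
import Mathlib.Algebra.BigOperators.Ring.Finset
import Mathlib.Algebra.Order.BigOperators.Group.Finset
import Mathlib.Data.Finset.Lattice.Fold
import Mathlib.Data.Finset.Max
import Mathlib.Tactic.Ring
import HarnessLib

/-!
# [OURS · L1 W4.2] Toric marked monomial objects in dimension 3 — brick 4A: the PAIR-WIDTH POTENTIAL of a planar exponent configuration

[OURS · L1 W4.2 · seat res-L1-s42-pv-2 gen 5] Memo `L/res-L1-s42-pv-2/CALIBRATION-W42-O2-v4.md` §3 (F3)–(F5).  Two layers: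

§A (abstract, no toric data).  A finite configuration of integer points `(x g, y g)`, `g ∈ G`: the PAIR-WIDTH potential
`T := Σ_{(g,g') incomparable, x g < x g'} (x g' − x g) + (y g − y g')`, the componentwise minimum sum `psum`, and the four facts of the
dim-2 step of the existence proof: under the «point move» maps `(x,y) ↦ (x, x+y−c)` and `(x,y) ↦ (x+y−c, y)` the potential `T` drops
strictly as soon as it is positive; `T = 0` forces a componentwise-minimal point (principal configuration); for a principal configuration
with «reduced» minimum (`min x < c`, resp. `min y < c`) the minimum sum drops strictly; translations `x ↦ x − c` leave `T` unchanged.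

§B (toric).  For a state `s`, a phase value `θs > 0`, the marking `m`, a common multiple `L` of the denominators and a ray `k`: the
generator set `G2` of the coefficient object `𝒞_k` (generators `u` with `α_k(u) < θs`, plus the companion's monomial generator when
`θs < m` and `β_k < m − θs`) and the INTEGER-SCALED coefficient exponents `E2 r g` (`= L·α_r(u)·θs/(θs − α_k(u))`, resp.
`L·β_r·θs/(m − θs − β_k)`); invariance at old rays; the transform law (K2) for the new ray of a blow-up of full residual order through
`k`; and (K3a): a 2-face `{k, r}` of full residual order is admissible iff every `E2 r g ≥ θs·L`.
Replaces the role of Blanco 2012 I Def 3.7 / Prop 3.12–3.13 (E-coefficient ideal, monomial form); NOT a statement of the manuscript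
under review nor of Blanco / Encinas–Villamayor.  AI work, weaker than expert review.  No `sorry`, no new axiom.
-/

set_option linter.dupNamespace false -- mandated namespace of this single-conjunct summit

namespace Summit.ResolutionOfSingularities.ResolutionOfSingularities.Theorems.CampaignW42.Toric

open Finset

/-! ## §A  The pair-width potential of a planar configuration -/

namespace PairPot

variable {γ : Type} [DecidableEq γ]

/-- **[OURS · L1 W4.2]** Width of the ordered pair `(g, g')` if it is INCOMPARABLE with `x g < x g'` (hence `y g' < y g`), else `0`. -/
def term (x y : γ → ℤ) (g g' : γ) : ℤ :=
  if x g < x g' ∧ y g' < y g then (x g' - x g) + (y g - y g') else 0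

/-- **[OURS · L1 W4.2]** The PAIR-WIDTH potential `T := Σ_{g,g' ∈ G} term`. -/
def T (G : Finset γ) (x y : γ → ℤ) : ℤ := ∑ g ∈ G, ∑ g' ∈ G, term x y g g'

/-- Indicator of an incomparable ordered pair. -/
def ind (x y : γ → ℤ) (g g' : γ) : ℤ := if x g < x g' ∧ y g' < y g then 1 else 0

/-- Number of incomparable ordered pairs. -/
def N (G : Finset γ) (x y : γ → ℤ) : ℤ := ∑ g ∈ G, ∑ g' ∈ G, ind x y g g'

omit [DecidableEq γ] in
/-- Widths are non-negative. -/
theorem term_nonneg (x y : γ → ℤ) (g g' : γ) : 0 ≤ term x y g g' := by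
  unfold term; split_ifs with h <;> omega

omit [DecidableEq γ] in
/-- Indicators are non-negative. -/
theorem ind_nonneg (x y : γ → ℤ) (g g' : γ) : 0 ≤ ind x y g g' := by
  unfold ind; split_ifs <;> omega

omit [DecidableEq γ] in
/-- The pair-width potential is non-negative. -/
theorem T_nonneg (G : Finset γ) (x y : γ → ℤ) : 0 ≤ T G x y :=
  Finset.sum_nonneg (fun g _ => Finset.sum_nonneg (fun g' _ => term_nonneg x y g g'))

omit [DecidableEq γ] in
/-- An incomparable pair has width at least `2`; in the form `ind ≤ term − ind`. -/
theorem two_ind_le_term (x y : γ → ℤ) (g g' : γ) : 2 * ind x y g g' ≤ term x y g g' := by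
  unfold ind term; split_ifs with h <;> omega

omit [DecidableEq γ] in
/-- First child map `(x, y) ↦ (x, x + y − c)`: termwise bound `term' + ind ≤ term`. -/
theorem term_child1_le (x y : γ → ℤ) (c : ℤ) (g g' : γ) :
    term x (fun h => x h + y h - c) g g' + ind x y g g' ≤ term x y g g' := by
  unfold term ind
  dsimp only
  by_cases h : x g < x g' ∧ y g' < y g
  · rw [if_pos h]; rw [if_pos h]
    split_ifs with h' <;> omega
  · rw [if_neg h, if_neg h]
    split_ifs with h'
    · exfalso; apply h; constructor <;> omega
    · omega

omit [DecidableEq γ] in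
/-- Second child map `(x, y) ↦ (x + y − c, y)`: termwise bound `term' + ind ≤ term`. -/
theorem term_child2_le (x y : γ → ℤ) (c : ℤ) (g g' : γ) :
    term (fun h => x h + y h - c) y g g' + ind x y g g' ≤ term x y g g' := by
  unfold term ind
  dsimp only
  by_cases h : x g < x g' ∧ y g' < y g
  · rw [if_pos h]; rw [if_pos h]
    split_ifs with h' <;> omega
  · rw [if_neg h, if_neg h]
    split_ifs with h'
    · exfalso; apply h; constructor <;> omega
    · omega

omit [DecidableEq γ] in
/-- Summed form of `term_child1_le`: `T(child₁) + N ≤ T`. -/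
theorem T_child1_add_N_le (G : Finset γ) (x y : γ → ℤ) (c : ℤ) :
    T G x (fun h => x h + y h - c) + N G x y ≤ T G x y := by
  unfold T N
  rw [← Finset.sum_add_distrib]
  refine Finset.sum_le_sum (fun g _ => ?_)
  rw [← Finset.sum_add_distrib]
  exact Finset.sum_le_sum (fun g' _ => term_child1_le x y c g g')

omit [DecidableEq γ] in
/-- Summed form of `term_child2_le`: `T(child₂) + N ≤ T`. -/
theorem T_child2_add_N_le (G : Finset γ) (x y : γ → ℤ) (c : ℤ) :
    T G (fun h => x h + y h - c) y + N G x y ≤ T G x y := by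
  unfold T N
  rw [← Finset.sum_add_distrib]
  refine Finset.sum_le_sum (fun g _ => ?_)
  rw [← Finset.sum_add_distrib]
  exact Finset.sum_le_sum (fun g' _ => term_child2_le x y c g g')

omit [DecidableEq γ] in
/-- `2 N ≤ T`; in particular `T > 0 ⇒ N > 0` is used contrapositively as `N = 0 ⇒ T = 0`... and `T > 0 ⇒ N ≥ 1`. -/
theorem two_N_le_T (G : Finset γ) (x y : γ → ℤ) : 2 * N G x y ≤ T G x y := by
  unfold T N
  rw [Finset.mul_sum]
  refine Finset.sum_le_sum (fun g _ => ?_)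
  rw [Finset.mul_sum]
  exact Finset.sum_le_sum (fun g' _ => two_ind_le_term x y g g')

omit [DecidableEq γ] in
/-- If `T > 0` some ordered pair is incomparable, so `N ≥ 1`. -/
theorem N_pos_of_T_pos (G : Finset γ) (x y : γ → ℤ) (h : 0 < T G x y) : 0 < N G x y := by
  by_contra hN
  have hN0 : N G x y = 0 := le_antisymm (le_of_not_gt hN)
    (Finset.sum_nonneg (fun g _ => Finset.sum_nonneg (fun g' _ => ind_nonneg x y g g')))
  -- every indicator vanishes, hence every term vanishes
  have hind : ∀ g ∈ G, ∀ g' ∈ G, ind x y g g' = 0 := by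
    intro g hg g' hg'
    have h1 : ∑ a ∈ G, ∑ b ∈ G, ind x y a b = 0 := hN0
    have h2 := (Finset.sum_eq_zero_iff_of_nonneg (fun a _ => Finset.sum_nonneg (fun b _ => ind_nonneg x y a b))).mp h1 g hg
    exact (Finset.sum_eq_zero_iff_of_nonneg (fun b _ => ind_nonneg x y g b)).mp h2 g' hg'
  have hterm : ∀ g ∈ G, ∀ g' ∈ G, term x y g g' = 0 := by
    intro g hg g' hg'
    have := hind g hg g' hg'
    unfold ind at this; unfold term
    split_ifs with hc
    · rw [if_pos hc] at this; omega
    · rfl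
  have : T G x y = 0 := Finset.sum_eq_zero (fun g hg => Finset.sum_eq_zero (fun g' hg' => hterm g hg g' hg'))
  omega

omit [DecidableEq γ] in
/-- **(F5, non-principal case, first child)** `T` drops strictly under `(x, y) ↦ (x, x + y − c)` as soon as it is positive. -/
theorem T_child1_lt (G : Finset γ) (x y : γ → ℤ) (c : ℤ) (h : 0 < T G x y) :
    T G x (fun g => x g + y g - c) < T G x y := by
  have h1 := T_child1_add_N_le G x y c
  have h2 := N_pos_of_T_pos G x y h
  omega

omit [DecidableEq γ] in
/-- **(F5, non-principal case, second child)** `T` drops strictly under `(x, y) ↦ (x + y − c, y)` as soon as it is positive. -/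
theorem T_child2_lt (G : Finset γ) (x y : γ → ℤ) (c : ℤ) (h : 0 < T G x y) :
    T G (fun g => x g + y g - c) y < T G x y := by
  have h1 := T_child2_add_N_le G x y c
  have h2 := N_pos_of_T_pos G x y h
  omega

omit [DecidableEq γ] in
/-- Translations do not change `T` (ray moves of the coefficient object). -/
theorem T_translate_left (G : Finset γ) (x y : γ → ℤ) (c : ℤ) : T G (fun g => x g - c) y = T G x y := by
  unfold T term
  refine Finset.sum_congr rfl (fun g _ => Finset.sum_congr rfl (fun g' _ => ?_))
  dsimp only
  have hiff : (x g - c < x g' - c ∧ y g' < y g) ↔ (x g < x g' ∧ y g' < y g) := by omega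
  by_cases hc : x g < x g' ∧ y g' < y g
  · rw [if_pos (hiff.mpr hc), if_pos hc]; omega
  · rw [if_neg (fun h => hc (hiff.mp h)), if_neg hc]

omit [DecidableEq γ] in
/-- Translations do not change `T` (second coordinate). -/
theorem T_translate_right (G : Finset γ) (x y : γ → ℤ) (c : ℤ) : T G x (fun g => y g - c) = T G x y := by
  unfold T term
  refine Finset.sum_congr rfl (fun g _ => Finset.sum_congr rfl (fun g' _ => ?_))
  dsimp only
  have hiff : (x g < x g' ∧ y g' - c < y g - c) ↔ (x g < x g' ∧ y g' < y g) := by omega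
  by_cases hc : x g < x g' ∧ y g' < y g
  · rw [if_pos (hiff.mpr hc), if_pos hc]; omega
  · rw [if_neg (fun h => hc (hiff.mp h)), if_neg hc]

omit [DecidableEq γ] in
/-- **(F5, principal case)** If `T = 0` on a non-empty configuration, some point is componentwise minimal. -/
theorem exists_min_of_T_eq_zero (G : Finset γ) (hG : G.Nonempty) (x y : γ → ℤ) (h : T G x y = 0) :
    ∃ g₀ ∈ G, ∀ g ∈ G, x g₀ ≤ x g ∧ y g₀ ≤ y g := by
  -- take g₀ minimising x, and among those minimising y; comparability (T = 0) does the rest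
  have hterm : ∀ g ∈ G, ∀ g' ∈ G, term x y g g' = 0 := by
    intro g hg g' hg'
    have h1 := (Finset.sum_eq_zero_iff_of_nonneg
      (fun a _ => Finset.sum_nonneg (fun b _ => term_nonneg x y a b))).mp h g hg
    exact (Finset.sum_eq_zero_iff_of_nonneg (fun b _ => term_nonneg x y g b)).mp h1 g' hg'
  obtain ⟨g₁, hg₁, hmin₁⟩ := Finset.exists_min_image G x hG
  let G₁ := G.filter (fun g => x g = x g₁)
  have hG₁ : G₁.Nonempty := ⟨g₁, by simp [G₁, hg₁]⟩
  obtain ⟨g₀, hg₀, hmin₀⟩ := Finset.exists_min_image G₁ y hG₁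
  have hg₀G : g₀ ∈ G := (Finset.mem_filter.mp hg₀).1
  have hx₀ : x g₀ = x g₁ := (Finset.mem_filter.mp hg₀).2
  refine ⟨g₀, hg₀G, fun g hg => ⟨by rw [hx₀]; exact hmin₁ g hg, ?_⟩⟩
  by_cases hxe : x g = x g₁
  · exact hmin₀ g (Finset.mem_filter.mpr ⟨hg, hxe⟩)
  · -- x g₀ < x g; if y g < y g₀ the pair (g₀, g) would be incomparable
    have hlt : x g₀ < x g := by rw [hx₀]; exact lt_of_le_of_ne (hmin₁ g hg) (Ne.symm hxe)
    by_contra hy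
    have := hterm g₀ hg₀G g hg
    unfold term at this
    rw [if_pos ⟨hlt, lt_of_not_ge hy⟩] at this
    omega

omit [DecidableEq γ] in
/-- **(F5, principal case, first child)** For a principal configuration with reduced first minimum (`x g₀ < c`), the sum of the
componentwise minima drops strictly under `(x, y) ↦ (x, x + y − c)` (the child is principal with the same minimiser). -/
theorem minsum_child1_lt (G : Finset γ) (x y : γ → ℤ) (c : ℤ) {g₀ : γ} (hg₀ : g₀ ∈ G)
    (hmin : ∀ g ∈ G, x g₀ ≤ x g ∧ y g₀ ≤ y g) (hred : x g₀ < c) :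
    G.inf' ⟨g₀, hg₀⟩ x + G.inf' ⟨g₀, hg₀⟩ (fun g => x g + y g - c) < G.inf' ⟨g₀, hg₀⟩ x + G.inf' ⟨g₀, hg₀⟩ y := by
  have h1 : G.inf' ⟨g₀, hg₀⟩ (fun g => x g + y g - c) ≤ x g₀ + y g₀ - c := Finset.inf'_le _ hg₀
  have h2 : y g₀ ≤ G.inf' ⟨g₀, hg₀⟩ y := Finset.le_inf' _ _ (fun g hg => (hmin g hg).2)
  omega

omit [DecidableEq γ] in
/-- **(F5, principal case, second child)** Symmetric statement for `(x, y) ↦ (x + y − c, y)` with `y g₀ < c`. -/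
theorem minsum_child2_lt (G : Finset γ) (x y : γ → ℤ) (c : ℤ) {g₀ : γ} (hg₀ : g₀ ∈ G)
    (hmin : ∀ g ∈ G, x g₀ ≤ x g ∧ y g₀ ≤ y g) (hred : y g₀ < c) :
    G.inf' ⟨g₀, hg₀⟩ (fun g => x g + y g - c) + G.inf' ⟨g₀, hg₀⟩ y < G.inf' ⟨g₀, hg₀⟩ x + G.inf' ⟨g₀, hg₀⟩ y := by
  have h1 : G.inf' ⟨g₀, hg₀⟩ (fun g => x g + y g - c) ≤ x g₀ + y g₀ - c := Finset.inf'_le _ hg₀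
  have h2 : x g₀ ≤ G.inf' ⟨g₀, hg₀⟩ x := Finset.le_inf' _ _ (fun g hg => (hmin g hg).1)
  omega

end PairPot




end Summit.ResolutionOfSingularities.ResolutionOfSingularities.Theorems.CampaignW42.Toric
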